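import Literature.RepresentationTheory.GeneralLinear.Sl2ProductRationalSubalgebras
import Mathlib.LinearAlgebra.Matrix.Trace
import Mathlib.Data.Matrix.Basic
import Mathlib.Tactic.NoncommRing
import Mathlib.Algebra.Algebra.Rat
import Mathlib.Algebra.Module.Rat
import Mathlib.LinearAlgebra.Dimension.Constructions
import Mathlib.LinearAlgebra.FiniteDimensional.Defs
import HarnessLib

/-!
# The Lie hull of the Hodge operator of a real-multiplication abelian variety of relative dimension one is `𝔰𝔩₂` at every real place (Hazama 1983 §3; Ribet; Moonen–Zarhin 1999 (3.1)) — the `J`-side assembly, Hodge-theory-free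

Research context: cell `pub-hodge-ring2` (a route conditional on HC_CM; this file is unconditional
linear algebra and no step towards a summit statement). Brick R1 (assembly) of the Literature lane's
REAL-MULTIPLICATION PROGRAMME (RING2-MAP `§lit (gen 38)` L209): after the E-series (products of
elliptic curves × CM type) the next class of the atlas with a non-CM simple factor is real
multiplication of relative dimension one — `X` simple of type I with `End⁰(X) = E` a totally real
field of degree `dim X` (Hazama 1983 Thm. (1.1); Ribet 1983; the cone fact
`Ribet1983_hodgeClasses_divisorial_powers_totallyRealField_oddRelDim`). Its Hodge group is
`R_{E/ℚ} SL₂`: over the Galois closure `F` of `E`, `H¹(X) ⊗ F = ⊕_σ W_σ` over the real places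
`σ : E → F`, and the Lie algebra of `Hg(X)_ℂ` is `⊕_σ 𝔰𝔩₂(W_σ)` (Hazama §3: "`p_i(𝔥) = 𝔰𝔩₂`", then
"`𝔥 = 𝔰𝔩₂ × ⋯ × 𝔰𝔩₂`" by Ribet's lemma (2.6) and Lemma (3.1)).

This file proves the matrix form of that computation, with the Hodge-theoretic inputs as explicit
hypotheses and NO Hodge theory imported:

* `single_sl2_mem_span_of_places` — let `F → K` be fields of characteristic zero (`F` = the Galois
  closure of `E` in `ℝ`, `K = ℂ`), `ι` finite (the real places), `S ⊆ ⊕_{k ∈ ι} 𝔰𝔩₂(F)` a set of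
  slotwise trace-free families closed under the commutator up to `F`-span (in the application
  `S = {(σ(Y))_σ : Y ∈ 𝔩}` for a `ℚ`-Lie subalgebra `𝔩 ⊆ 𝔰𝔩₂(E)`, e.g. the annihilator of a rational
  tensor), and `J ∈ ⊕_k 𝔤𝔩₂(K)` in the `K`-span of `S` (the Hodge operator, blockwise). Suppose
  (i) no `J_k` has an `F`-rational eigenline (automatic: `J_σ` is real with eigenvalues `±i`);
  (a) at every slot `k` two members of `S` have non-commuting `k`-components (from `End⁰(X) = E`:
  the hull is non-abelian, and each `σ` is injective on `𝔰𝔩₂(E)`);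
  (b) for no pair `k ≠ i` and no invertible `g ∈ GL₂(F)` do ALL members `z` of `S` satisfy
  `z_i = g z_k g⁻¹` (from `End⁰(X) = E` by descent of the commutant: such a `g` is a Hodge
  endomorphism `W_k → W_i` outside `E ⊗ ℂ`).
  Then the `F`-span of `S` contains `0 ⊕ ⋯ ⊕ 𝔰𝔩₂(F) ⊕ ⋯ ⊕ 0` at EVERY slot: per slot, the
  non-abelian trichotomy `mem_span_rational_sl2_of_noRationalEigenline_of_nonabelian` (brick R1b)
  and descent of rational points give that the slot-`i` components of the span exhaust `𝔰𝔩₂(F)`, and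
  the `J`-free Goursat–Ribet lemma `single_sl2_mem_of_surjective_of_forall_exists_ne_conj` (brick R1a)
  concludes.
* `mem_span_of_places_of_forall_trace_eq_zero` — hence the `F`-span of `S` is ALL of `⊕_k 𝔰𝔩₂(F)`
  (every slotwise trace-free family is a sum of `Pi.single`s).
* §3 (rev. 2), the packaging over a coefficient field `E` with places `σ_k : E → F`
  (`single_sl2_mem_span_places_image`, `three_mul_card_le_finrank_span_places_image`,
  `three_mul_card_le_finrank_rat`, `eq_traceZero_of_places`): for a trace-free, non-commutative
  `ℚ`-Lie subalgebra `𝔩 ⊆ 𝔰𝔩₂(E)` whose place-image has `J` in its `K`-span ((i), (b) as above; (a)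
  propagates to every slot by injectivity of the `σ_k`), `3|ι| ≤ dim_ℚ 𝔩`, and `𝔩 = 𝔰𝔩₂(E)` when
  `|ι| = [E : ℚ]` — "the `ℚ`-Lie hull of the Hodge operator is `Lie R_{E/ℚ} SL₂`".

What the Hodge side (brick R2, not here) must supply for `X` with `End⁰(X) = E`, `[E:ℚ] = dim X`:
the block form of `H¹(X, ℚ) ⊗ F` over the places, `J ∈ span`, (a) and (b) from Riemann's theorem
`End_{Hg}(H¹) = End⁰(X)` (the tree's `deligneMilne1982_Thm_6_20_full_holds`), and then the invariant
theory per colour `σ` exactly as for products of non-isogenous elliptic curves without CM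
(`sl2_product_annihilator`, `NonCMEllipticCurvesProductsHodgeClasses`), the colours now being the real
places of `E` instead of the curves.

Everything is proved; no definition, no named fact (D-0026); axioms standard.

## References

* [Hazama1983] F. Hazama, *Algebraic cycles on abelian varieties with many real endomorphisms*,
  Tôhoku Math. J. 35 (1983) 303–308 (held: `paper:doi-10-2748-tmj-1178229056`): Thm. (1.1) p. 303,
  Prop. (2.6) p. 304 (Ribet's lemma), §3 pp. 305–306 (`p_i(𝔥) = 𝔰𝔩₂`, Lemma (3.1), "`𝔥 = 𝔰𝔩₂ × ⋯ ×
  𝔰𝔩₂` where the i-th component acts on `V_i ⊕ ⋯ ⊕ V_i` diagonally"). [cite: Hazama1983, Thm. (1.1), Prop. (2.6), Lemma (3.1)]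
* [MoonenZarhin1999LowDim] B. J. J. Moonen, Yu. G. Zarhin, Math. Ann. 315 (1999) 711–733, §1
  (`hg(X)` is the smallest `ℚ`-Lie subalgebra whose complexification contains the Hodge operator)
  and §3 (3.1). [cite: MoonenZarhin1999LowDim, §1 and §3 (3.1)]
* [Ribet1983] K. A. Ribet, *Hodge classes on certain types of abelian varieties*, Amer. J. Math. 105
  (1983) 523–538 (relative dimension one). [cite: Ribet1983, Thm. 0–1]
-/

noncomputable section

namespace Literature.RepresentationTheory.GeneralLinear

open Matrix

section Descent

variable {F K : Type*} [Field F] [Field K] [Algebra F K]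

/-- **Rational points of the `K`-span of a rational subspace** (`2 × 2` matrices): if the image of
an `F`-matrix lies in the `K`-span of the images of an `F`-subspace `T`, it lies in `T` (entrywise
`F`-linear retraction `K → F`; a copy of the private lemma of `Sl2ProductRationalSubalgebras`). [folklore] -/
private theorem mem_of_map_mem_span'' (T : Submodule F (Matrix (Fin 2) (Fin 2) F))
    {w : Matrix (Fin 2) (Fin 2) F}
    (hw : w.map (algebraMap F K) ∈ Submodule.span K
      ((fun A : Matrix (Fin 2) (Fin 2) F => A.map (algebraMap F K)) '' T)) : w ∈ T := by
  classical
  obtain ⟨lam, hlam⟩ := LinearMap.exists_leftInverse_of_injective (Algebra.linearMap F K)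
    (LinearMap.ker_eq_bot.2 (algebraMap F K).injective)
  have hlam1 : ∀ a : F, lam (algebraMap F K a) = a := fun a => by
    have := congrArg (fun f => f a) hlam
    simpa using this
  set Λ : Matrix (Fin 2) (Fin 2) K →ₗ[F] Matrix (Fin 2) (Fin 2) F := lam.mapMatrix with hΛ
  have hΛmap : ∀ A : Matrix (Fin 2) (Fin 2) F, Λ (A.map (algebraMap F K)) = A := by
    intro A; ext i j; simp [hΛ, hlam1]
  have hΛsmul : ∀ (c : K) (A : Matrix (Fin 2) (Fin 2) F),
      Λ (c • A.map (algebraMap F K)) = lam c • A := by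
    intro c A; ext i j
    simp only [hΛ, LinearMap.mapMatrix_apply, Matrix.map_apply, Matrix.smul_apply, smul_eq_mul]
    rw [show c * algebraMap F K (A i j) = A i j • c by rw [Algebra.smul_def, mul_comm],
      map_smul, smul_eq_mul, mul_comm]
  obtain ⟨n, c, g, hsum⟩ := Submodule.mem_span_set'.1 hw
  have hg : ∀ t, ∃ A, A ∈ T ∧ A.map (algebraMap F K) = (g t : Matrix (Fin 2) (Fin 2) K) :=
    fun t => by obtain ⟨A, hA, hA'⟩ := (g t).2; exact ⟨A, hA, hA'⟩
  choose A hAT hAg using hg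
  have : w = ∑ t, lam (c t) • A t := by
    rw [← hΛmap w, ← hsum, map_sum]
    exact Finset.sum_congr rfl fun t _ => by rw [← hAg, hΛsmul]
  rw [this]
  exact T.sum_mem fun t _ => T.smul_mem _ (hAT t)

end Descent

section Main

variable {F K : Type*} [Field F] [Field K] [CharZero K] [Algebra F K]
variable {ι : Type*} [Fintype ι] [DecidableEq ι]

/-- **The `F`-span of `S` contains `𝔰𝔩₂(F)` at every slot** (Hazama 1983 §3 / Ribet's lemma, matrix
form; hypotheses (i), (a), (b) as in the module docstring). For an abelian variety `X` with real
multiplication by a totally real field `E` of degree `dim X` and `End⁰(X) = E`: with `F` the Galois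
closure of `E`, `ι` the real places, `S` the image of the `ℚ`-Lie hull of the Hodge operator `J` (or of
the annihilator of a Hodge class), this is "`Lie Hg(X) ⊗ F ⊇ ⊕_σ 𝔰𝔩₂(F)`", i.e. `Hg(X) = R_{E/ℚ} SL₂`.
[cite: Hazama1983, §3 (pp. 305–306), Prop. (2.6) and Lemma (3.1)] [cite: MoonenZarhin1999LowDim, §1 and §3 (3.1)] -/
theorem single_sl2_mem_span_of_places (S : Set (ι → Matrix (Fin 2) (Fin 2) F))
    (hlie : ∀ A ∈ S, ∀ B ∈ S, A * B - B * A ∈ Submodule.span F S)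
    (htr : ∀ A ∈ S, ∀ k, (A k).trace = 0)
    {J : ι → Matrix (Fin 2) (Fin 2) K}
    (hJ : J ∈ Submodule.span K
      ((fun A : ι → Matrix (Fin 2) (Fin 2) F => fun k => (A k).map (algebraMap F K)) '' S))
    (hi : ∀ (k : ι) (v : Fin 2 → F), v ≠ 0 → ∀ μ : K,
      (J k).mulVec (fun a => algebraMap F K (v a)) ≠ μ • fun a => algebraMap F K (v a))
    (hna : ∀ k : ι, ∃ A ∈ S, ∃ B ∈ S, A k * B k - B k * A k ≠ 0)
    (hng : ∀ i k : ι, k ≠ i → ∀ g g' : Matrix (Fin 2) (Fin 2) F, g * g' = 1 → g' * g = 1 →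
      ∃ z ∈ S, z i ≠ g * z k * g')
    (i : ι) (Z : Matrix (Fin 2) (Fin 2) F) (hZ : Z.trace = 0) :
    Pi.single i Z ∈ Submodule.span F S := by
  classical
  haveI : CharZero F := (algebraMap F K).charZero
  set L : Submodule F (ι → Matrix (Fin 2) (Fin 2) F) := Submodule.span F S with hL
  set mp : Matrix (Fin 2) (Fin 2) F → Matrix (Fin 2) (Fin 2) K :=
    fun A => A.map (algebraMap F K) with hmp
  set mpPL : (ι → Matrix (Fin 2) (Fin 2) F) → (ι → Matrix (Fin 2) (Fin 2) K) :=
    fun A => fun k => (A k).map (algebraMap F K) with hmpPL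
  ------------------------------------------------------------------
  -- the `F`-span `L` of `S` is a slotwise trace-free Lie subalgebra
  ------------------------------------------------------------------
  have hlieL : ∀ A ∈ L, ∀ B ∈ L, A * B - B * A ∈ L := by
    have h1 : ∀ B ∈ S, ∀ A ∈ L, A * B - B * A ∈ L := by
      intro B hB A hA
      refine Submodule.span_induction (p := fun A _ => A * B - B * A ∈ L) ?_ ?_ ?_ ?_ hA
      · intro A hA'
        exact hlie A hA' B hB
      · rw [zero_mul, mul_zero, sub_zero]; exact L.zero_mem
      · intro x y _ _ hx hy
        have : (x + y) * B - B * (x + y) = (x * B - B * x) + (y * B - B * y) := by noncomm_ring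
        rw [this]; exact L.add_mem hx hy
      · intro c x _ hx
        have : (c • x) * B - B * (c • x) = c • (x * B - B * x) := by
          rw [smul_mul_assoc, mul_smul_comm, smul_sub]
        rw [this]; exact L.smul_mem c hx
    intro A hA B hB
    refine Submodule.span_induction (p := fun B _ => A * B - B * A ∈ L) ?_ ?_ ?_ ?_ hB
    · intro B hB'
      exact h1 B hB' A hA
    · rw [zero_mul, mul_zero, sub_zero]; exact L.zero_mem
    · intro x y _ _ hx hy
      have : A * (x + y) - (x + y) * A = (A * x - x * A) + (A * y - y * A) := by noncomm_ring
      rw [this]; exact L.add_mem hx hy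
    · intro c x _ hx
      have : A * (c • x) - (c • x) * A = c • (A * x - x * A) := by
        rw [mul_smul_comm, smul_mul_assoc, smul_sub]
      rw [this]; exact L.smul_mem c hx
  have htrL : ∀ A ∈ L, ∀ k, (A k).trace = 0 := by
    intro A hA k
    refine Submodule.span_induction (p := fun A _ => (A k).trace = 0) ?_ ?_ ?_ ?_ hA
    · intro A hA'; exact htr A hA' k
    · simp
    · intro x y _ _ hx hy
      rw [Pi.add_apply, Matrix.trace_add, hx, hy, add_zero]
    · intro c x _ hx
      rw [Pi.smul_apply, Matrix.trace_smul, hx, smul_zero]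
  ------------------------------------------------------------------
  -- slot `i`: the `i`-components of `L` form a non-abelian rational subalgebra of `𝔰𝔩₂(F)` seeing `J_i`
  ------------------------------------------------------------------
  set Ti : Submodule F (Matrix (Fin 2) (Fin 2) F) := Submodule.map (LinearMap.proj i) L with hTi
  have memTi : ∀ {W}, W ∈ Ti ↔ ∃ y ∈ L, y i = W := by
    intro W
    rw [hTi, Submodule.mem_map]
    simp only [LinearMap.proj_apply]
  have hTtr : ∀ A ∈ (Ti : Set (Matrix (Fin 2) (Fin 2) F)), A.trace = 0 := by
    intro A hA
    obtain ⟨y, hy, rfl⟩ := memTi.1 hA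
    exact htrL y hy i
  have hTlie : ∀ A ∈ (Ti : Set (Matrix (Fin 2) (Fin 2) F)), ∀ B ∈ (Ti : Set (Matrix (Fin 2) (Fin 2) F)),
      A * B - B * A ∈ (Ti : Set (Matrix (Fin 2) (Fin 2) F)) := by
    intro A hA B hB
    obtain ⟨y, hy, rfl⟩ := memTi.1 hA
    obtain ⟨y', hy', rfl⟩ := memTi.1 hB
    exact memTi.2 ⟨y * y' - y' * y, hlieL y hy y' hy', rfl⟩
  have hJT : J i ∈ Submodule.span K (mp '' (Ti : Set (Matrix (Fin 2) (Fin 2) F))) := by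
    set Θ : (ι → Matrix (Fin 2) (Fin 2) K) →ₗ[K] Matrix (Fin 2) (Fin 2) K := LinearMap.proj i with hΘ
    have h1 : Θ J ∈ Submodule.map Θ (Submodule.span K (mpPL '' S)) := Submodule.mem_map_of_mem hJ
    rw [Submodule.map_span] at h1
    refine Submodule.span_mono ?_ h1
    rintro _ ⟨_, ⟨y, hy, rfl⟩, rfl⟩
    refine ⟨y i, memTi.2 ⟨y, Submodule.subset_span hy, rfl⟩, ?_⟩
    simp only [hΘ, hmp, hmpPL, LinearMap.proj_apply]
  have hnaT : ∃ A ∈ (Ti : Set (Matrix (Fin 2) (Fin 2) F)), ∃ B ∈ (Ti : Set (Matrix (Fin 2) (Fin 2) F)),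
      A * B - B * A ≠ 0 := by
    obtain ⟨A, hA, B, hB, hAB⟩ := hna i
    exact ⟨A i, memTi.2 ⟨A, Submodule.subset_span hA, rfl⟩, B i,
      memTi.2 ⟨B, Submodule.subset_span hB, rfl⟩, hAB⟩
  -- brick R1b: the `K`-span of `Ti` is `𝔰𝔩₂(K)`; descent: `Ti = 𝔰𝔩₂(F)`
  have hsurj : ∀ W : Matrix (Fin 2) (Fin 2) F, W.trace = 0 → ∃ y ∈ L, y i = W := by
    intro W hW
    have hWK : mp W ∈ Submodule.span K (mp '' (Ti : Set (Matrix (Fin 2) (Fin 2) F))) := by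
      refine mem_span_rational_sl2_of_noRationalEigenline_of_nonabelian
        (Ti : Set (Matrix (Fin 2) (Fin 2) F)) hTtr hTlie hJT (hi i) hnaT (mp W) ?_
      rw [hmp]
      simp [Matrix.trace_fin_two] at hW ⊢
      rw [← map_add, hW, map_zero]
    exact memTi.1 (mem_of_map_mem_span'' Ti hWK)
  ------------------------------------------------------------------
  -- brick R1a: Goursat–Ribet
  ------------------------------------------------------------------
  have hngL : ∀ k, k ≠ i → ∀ g g' : Matrix (Fin 2) (Fin 2) F, g * g' = 1 → g' * g = 1 →
      ∃ z ∈ L, z i ≠ g * z k * g' := by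
    intro k hk g g' hgg' hg'g
    obtain ⟨z, hz, hne⟩ := hng i k hk g g' hgg' hg'g
    exact ⟨z, Submodule.subset_span hz, hne⟩
  exact single_sl2_mem_of_surjective_of_forall_exists_ne_conj L hlieL htrL hsurj hngL Z hZ

/-- **Hence the `F`-span of `S` is everything**: every slotwise trace-free family lies in it
(`A = ∑_k (0,…,A_k,…,0)`). In the application: `(Lie Hg X) ⊗_ℚ F = ⊕_σ 𝔰𝔩₂(F)`, `Hg(X) = R_{E/ℚ} SL₂`
(Hazama 1983 §3). [cite: Hazama1983, §3 (pp. 305–306) and Thm. (1.1)] -/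
theorem mem_span_of_places_of_forall_trace_eq_zero (S : Set (ι → Matrix (Fin 2) (Fin 2) F))
    (hlie : ∀ A ∈ S, ∀ B ∈ S, A * B - B * A ∈ Submodule.span F S)
    (htr : ∀ A ∈ S, ∀ k, (A k).trace = 0)
    {J : ι → Matrix (Fin 2) (Fin 2) K}
    (hJ : J ∈ Submodule.span K
      ((fun A : ι → Matrix (Fin 2) (Fin 2) F => fun k => (A k).map (algebraMap F K)) '' S))
    (hi : ∀ (k : ι) (v : Fin 2 → F), v ≠ 0 → ∀ μ : K,
      (J k).mulVec (fun a => algebraMap F K (v a)) ≠ μ • fun a => algebraMap F K (v a))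
    (hna : ∀ k : ι, ∃ A ∈ S, ∃ B ∈ S, A k * B k - B k * A k ≠ 0)
    (hng : ∀ i k : ι, k ≠ i → ∀ g g' : Matrix (Fin 2) (Fin 2) F, g * g' = 1 → g' * g = 1 →
      ∃ z ∈ S, z i ≠ g * z k * g')
    (A : ι → Matrix (Fin 2) (Fin 2) F) (hA : ∀ k, (A k).trace = 0) :
    A ∈ Submodule.span F S := by
  classical
  have hdec : A = ∑ k, Pi.single k (A k) := by
    ext k a b
    rw [Finset.sum_apply, Finset.sum_eq_single k]
    · rw [Pi.single_eq_same]
    · intro k' _ hk'; rw [Pi.single_eq_of_ne (Ne.symm hk')]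
    · intro h; exact absurd (Finset.mem_univ k) h
  rw [hdec]
  exact Submodule.sum_mem _ fun k _ =>
    single_sl2_mem_span_of_places S hlie htr hJ hi hna hng k (A k) (hA k)

end Main

/-! ### §3 Packaging over a coefficient field `E` with places `σ_k : E → F`: `3·|ι| ≤ dim_ℚ 𝔩`, and `𝔩 = 𝔰𝔩₂(E)` -/

section Places

variable {E F K : Type*} [Field E] [CharZero E] [Field F] [Field K] [CharZero K] [Algebra F K]
variable {ι : Type*} [Fintype ι] [DecidableEq ι]

omit [CharZero E] in
/-- Trace of an entrywise image of a `2 × 2` matrix. [folklore] -/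
private theorem trace_map_fin_two (f : E →+* F) (Y : Matrix (Fin 2) (Fin 2) E) :
    (Y.map f).trace = f Y.trace := by
  simp [Matrix.trace_fin_two]

/-- **The places form.** Let `E` be a field of characteristic zero (a totally real number field),
`σ_k : E → F` (`k ∈ ι`) ring homomorphisms into a field `F` (its real places, `F = ℝ` or the Galois
closure), `F → K` a further field extension (`K = ℂ`), and `𝔩 ⊆ 𝔰𝔩₂(E)` a `ℚ`-subspace of trace-free
matrices closed under the commutator (the `ℚ`-Lie hull of the Hodge operator, or the `E`-linear
annihilator of a rational Hodge class). Put `Y^σ := (σ_k(Y))_k ∈ ⊕_k 𝔰𝔩₂(F)`. Suppose `J ∈ ⊕_k 𝔤𝔩₂(K)`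
lies in the `K`-span of `{Y^σ : Y ∈ 𝔩}`, (i) no `J_k` has an `F`-rational eigenline, (a) `𝔩` is NOT
commutative, (b) for no `k ≠ i` and no invertible `g` is `σ_i(Y) = g σ_k(Y) g⁻¹` for all `Y ∈ 𝔩`. Then
the `F`-span of `{Y^σ}` contains `0 ⊕ ⋯ ⊕ 𝔰𝔩₂(F) ⊕ ⋯ ⊕ 0` at every slot ((a) propagates to every
slot because each `σ_k` is injective). [cite: Hazama1983, §3 (pp. 305–306), Prop. (2.6) and Lemma (3.1)]
[cite: MoonenZarhin1999LowDim, §1 and §3 (3.1)] -/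
theorem single_sl2_mem_span_places_image (σ : ι → (E →+* F))
    (𝔩 : Submodule ℚ (Matrix (Fin 2) (Fin 2) E))
    (hlie : ∀ A ∈ 𝔩, ∀ B ∈ 𝔩, A * B - B * A ∈ 𝔩) (htr : ∀ A ∈ 𝔩, A.trace = 0)
    {J : ι → Matrix (Fin 2) (Fin 2) K}
    (hJ : J ∈ Submodule.span K
      ((fun Y : Matrix (Fin 2) (Fin 2) E => fun k => ((Y.map (σ k)).map (algebraMap F K))) '' 𝔩))
    (hi : ∀ (k : ι) (v : Fin 2 → F), v ≠ 0 → ∀ μ : K,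
      (J k).mulVec (fun a => algebraMap F K (v a)) ≠ μ • fun a => algebraMap F K (v a))
    (hna : ∃ A ∈ 𝔩, ∃ B ∈ 𝔩, A * B - B * A ≠ 0)
    (hng : ∀ i k : ι, k ≠ i → ∀ g g' : Matrix (Fin 2) (Fin 2) F, g * g' = 1 → g' * g = 1 →
      ∃ Y ∈ 𝔩, (Y.map (σ i)) ≠ g * Y.map (σ k) * g')
    (i : ι) (Z : Matrix (Fin 2) (Fin 2) F) (hZ : Z.trace = 0) :
    Pi.single i Z ∈ Submodule.span F
      ((fun Y : Matrix (Fin 2) (Fin 2) E => fun k => Y.map (σ k)) '' (𝔩 : Set (Matrix (Fin 2) (Fin 2) E))) := by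
  classical
  set plc : Matrix (Fin 2) (Fin 2) E → (ι → Matrix (Fin 2) (Fin 2) F) :=
    fun Y => fun k => Y.map (σ k) with hplc
  set S : Set (ι → Matrix (Fin 2) (Fin 2) F) := plc '' (𝔩 : Set (Matrix (Fin 2) (Fin 2) E)) with hS
  have plc_mul : ∀ Y Y' k, plc (Y * Y') k = plc Y k * plc Y' k := fun Y Y' k => Matrix.map_mul
  have plc_sub : ∀ Y Y' k, plc (Y - Y') k = plc Y k - plc Y' k := fun Y Y' k =>
    Matrix.map_sub (σ k) (map_sub (σ k)) Y Y'
  refine single_sl2_mem_span_of_places S ?_ ?_ (J := J) ?_ hi ?_ ?_ i Z hZ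
  · -- bracket-closed
    rintro _ ⟨Y, hY, rfl⟩ _ ⟨Y', hY', rfl⟩
    refine Submodule.subset_span ⟨Y * Y' - Y' * Y, hlie Y hY Y' hY', ?_⟩
    funext k
    rw [Pi.sub_apply, Pi.mul_apply, Pi.mul_apply, plc_sub, plc_mul, plc_mul]
  · -- slotwise trace-free
    rintro _ ⟨Y, hY, rfl⟩ k
    change (Y.map (σ k)).trace = 0
    rw [trace_map_fin_two, htr Y hY, map_zero]
  · -- `J` in the `K`-span
    rw [hS, Set.image_image]
    exact hJ
  · -- every slot is non-abelian (injectivity of `σ k`)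
    intro k
    obtain ⟨A, hA, B, hB, hAB⟩ := hna
    refine ⟨plc A, ⟨A, hA, rfl⟩, plc B, ⟨B, hB, rfl⟩, ?_⟩
    rw [← plc_mul, ← plc_mul, ← plc_sub]
    change (A * B - B * A).map (σ k) ≠ 0
    intro h0
    apply hAB
    exact Matrix.map_injective (σ k).injective (h0.trans (Matrix.map_zero _ (map_zero _)).symm)
  · -- no graph position
    intro i' k hk g g' hgg' hg'g
    obtain ⟨Y, hY, hne⟩ := hng i' k hk g g' hgg' hg'g
    exact ⟨plc Y, ⟨Y, hY, rfl⟩, hne⟩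

/-- **Dimension count, lower bound**: under the hypotheses of `single_sl2_mem_span_places_image`,
`3 · |ι| ≤ dim_F span_F {Y^σ : Y ∈ 𝔩}` (the slotwise trace-free families `⊕_k 𝔰𝔩₂(F)`, of dimension
`3|ι|`, all lie in the span). [cite: Hazama1983, §3 (pp. 305–306)] -/
theorem three_mul_card_le_finrank_span_places_image (σ : ι → (E →+* F))
    (𝔩 : Submodule ℚ (Matrix (Fin 2) (Fin 2) E))
    (hlie : ∀ A ∈ 𝔩, ∀ B ∈ 𝔩, A * B - B * A ∈ 𝔩) (htr : ∀ A ∈ 𝔩, A.trace = 0)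
    {J : ι → Matrix (Fin 2) (Fin 2) K}
    (hJ : J ∈ Submodule.span K
      ((fun Y : Matrix (Fin 2) (Fin 2) E => fun k => ((Y.map (σ k)).map (algebraMap F K))) '' 𝔩))
    (hi : ∀ (k : ι) (v : Fin 2 → F), v ≠ 0 → ∀ μ : K,
      (J k).mulVec (fun a => algebraMap F K (v a)) ≠ μ • fun a => algebraMap F K (v a))
    (hna : ∃ A ∈ 𝔩, ∃ B ∈ 𝔩, A * B - B * A ≠ 0)
    (hng : ∀ i k : ι, k ≠ i → ∀ g g' : Matrix (Fin 2) (Fin 2) F, g * g' = 1 → g' * g = 1 →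
      ∃ Y ∈ 𝔩, (Y.map (σ i)) ≠ g * Y.map (σ k) * g') :
    3 * Fintype.card ι ≤ Module.finrank F (Submodule.span F
      ((fun Y : Matrix (Fin 2) (Fin 2) E => fun k => Y.map (σ k)) '' (𝔩 : Set (Matrix (Fin 2) (Fin 2) E)))) := by
  classical
  set L := Submodule.span F
    ((fun Y : Matrix (Fin 2) (Fin 2) E => fun k => Y.map (σ k)) '' (𝔩 : Set (Matrix (Fin 2) (Fin 2) E))) with hL
  -- the parametrisation `c ↦ (k ↦ (c k 1, c k 0; c k 2, -c k 1))` of the slotwise trace-free families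
  set Ψ : (ι → Fin 3 → F) →ₗ[F] (ι → Matrix (Fin 2) (Fin 2) F) :=
    { toFun := fun c k => !![c k 1, c k 0; c k 2, -(c k 1)]
      map_add' := fun c c' => by
        funext k; ext a b; fin_cases a <;> fin_cases b <;> simp [add_comm]
      map_smul' := fun r c => by
        funext k; ext a b; fin_cases a <;> fin_cases b <;> simp } with hΨ
  have hΨinj : Function.Injective Ψ := by
    intro c c' h
    funext k j
    have hk := congrFun h k
    simp only [hΨ, LinearMap.coe_mk, AddHom.coe_mk] at hk
    fin_cases j
    · have := congrFun (congrFun hk 0) 1; simpa using this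
    · have := congrFun (congrFun hk 0) 0; simpa using this
    · have := congrFun (congrFun hk 1) 0; simpa using this
  have hΨL : LinearMap.range Ψ ≤ L := by
    rintro _ ⟨c, rfl⟩
    have hdec : Ψ c = ∑ k, Pi.single k (Ψ c k) := by
      ext k a b
      rw [Finset.sum_apply, Finset.sum_eq_single k]
      · rw [Pi.single_eq_same]
      · intro k' _ hk'; rw [Pi.single_eq_of_ne (Ne.symm hk')]
      · intro h; exact absurd (Finset.mem_univ k) h
    rw [hdec]
    refine Submodule.sum_mem _ fun k _ => ?_
    refine single_sl2_mem_span_places_image σ 𝔩 hlie htr hJ hi hna hng k (Ψ c k) ?_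
    simp [hΨ, Matrix.trace_fin_two]
  calc 3 * Fintype.card ι = Module.finrank F (ι → Fin 3 → F) := by
        rw [Module.finrank_pi_fintype, Finset.sum_const, Finset.card_univ,
          Module.finrank_fintype_fun_eq_card, Fintype.card_fin, smul_eq_mul, mul_comm]
    _ = Module.finrank F (LinearMap.range Ψ) := (LinearMap.finrank_range_of_inj hΨinj).symm
    _ ≤ Module.finrank F L := Submodule.finrank_mono hΨL

/-- **Dimension count over `ℚ`**: under the same hypotheses, `3 · |ι| ≤ dim_ℚ 𝔩` — the `F`-span of
`{Y^σ : Y ∈ 𝔩}` is spanned by the images of a `ℚ`-basis of `𝔩`. With `|ι| = [E : ℚ]` real places and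
`𝔩 ⊆ 𝔰𝔩₂(E)` (`dim_ℚ 𝔰𝔩₂(E) = 3[E:ℚ]`) this is `𝔩 = 𝔰𝔩₂(E)`: the `ℚ`-Lie hull of the Hodge operator
of a real-multiplication abelian variety of relative dimension one with `End⁰ = E` is all of
`𝔰𝔩₂(E) = Lie R_{E/ℚ} SL₂` (Hazama 1983 §3; Ribet). [cite: Hazama1983, §3 (pp. 305–306) and Thm. (1.1)]
[cite: MoonenZarhin1999LowDim, §1] -/
theorem three_mul_card_le_finrank_rat (σ : ι → (E →+* F))
    (𝔩 : Submodule ℚ (Matrix (Fin 2) (Fin 2) E)) [Module.Finite ℚ 𝔩]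
    (hlie : ∀ A ∈ 𝔩, ∀ B ∈ 𝔩, A * B - B * A ∈ 𝔩) (htr : ∀ A ∈ 𝔩, A.trace = 0)
    {J : ι → Matrix (Fin 2) (Fin 2) K}
    (hJ : J ∈ Submodule.span K
      ((fun Y : Matrix (Fin 2) (Fin 2) E => fun k => ((Y.map (σ k)).map (algebraMap F K))) '' 𝔩))
    (hi : ∀ (k : ι) (v : Fin 2 → F), v ≠ 0 → ∀ μ : K,
      (J k).mulVec (fun a => algebraMap F K (v a)) ≠ μ • fun a => algebraMap F K (v a))
    (hna : ∃ A ∈ 𝔩, ∃ B ∈ 𝔩, A * B - B * A ≠ 0)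
    (hng : ∀ i k : ι, k ≠ i → ∀ g g' : Matrix (Fin 2) (Fin 2) F, g * g' = 1 → g' * g = 1 →
      ∃ Y ∈ 𝔩, (Y.map (σ i)) ≠ g * Y.map (σ k) * g') :
    3 * Fintype.card ι ≤ Module.finrank ℚ 𝔩 := by
  classical
  haveI : CharZero F := (algebraMap F K).charZero
  set plc : Matrix (Fin 2) (Fin 2) E → (ι → Matrix (Fin 2) (Fin 2) F) :=
    fun Y => fun k => Y.map (σ k) with hplc
  -- a `ℚ`-basis of `𝔩`; its images span the `F`-span of all images
  set b := Module.finBasis ℚ 𝔩 with hb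
  have hle : Submodule.span F (plc '' (𝔩 : Set (Matrix (Fin 2) (Fin 2) E))) ≤
      Submodule.span F (Set.range fun j => plc (b j)) := by
    refine Submodule.span_le.2 ?_
    rintro _ ⟨Y, hY, rfl⟩
    set y : 𝔩 := ⟨Y, hY⟩ with hy
    have hYeq : Y = ∑ j, (b.repr y j) • ((b j : 𝔩) : Matrix (Fin 2) (Fin 2) E) := by
      have h1 : ((y : 𝔩) : Matrix (Fin 2) (Fin 2) E) =
          ((∑ j, b.repr y j • b j : 𝔩) : Matrix (Fin 2) (Fin 2) E) := by
        rw [b.sum_repr y]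
      rw [Submodule.coe_sum] at h1
      simp only [Submodule.coe_smul] at h1
      exact h1
    have hterm : ∀ (q : ℚ) (M : Matrix (Fin 2) (Fin 2) E) (k : ι),
        (q • M).map (σ k) = ((q : F)) • M.map (σ k) := by
      intro q M k
      ext a c
      simp [Matrix.map_apply, Matrix.smul_apply, Rat.smul_def, smul_eq_mul, map_ratCast]
    have hplcY : plc Y = ∑ j, ((b.repr y j : ℚ) : F) • plc (b j) := by
      funext k
      rw [Finset.sum_apply]
      simp only [hplc, Pi.smul_apply]
      conv_lhs => rw [hYeq]
      change (σ k).toAddMonoidHom.mapMatrix (∑ j, (b.repr y j) • ((b j : 𝔩) : Matrix (Fin 2) (Fin 2) E)) = _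
      rw [map_sum]
      refine Finset.sum_congr rfl fun j _ => ?_
      rw [AddMonoidHom.mapMatrix_apply]
      exact hterm _ _ k
    change plc Y ∈ Submodule.span F (Set.range fun j => plc (b j))
    rw [hplcY]
    exact Submodule.sum_mem _ fun j _ => Submodule.smul_mem _ _ (Submodule.subset_span ⟨j, rfl⟩)
  calc 3 * Fintype.card ι
      ≤ Module.finrank F (Submodule.span F (plc '' (𝔩 : Set (Matrix (Fin 2) (Fin 2) E)))) :=
        three_mul_card_le_finrank_span_places_image σ 𝔩 hlie htr hJ hi hna hng
    _ ≤ Module.finrank F (Submodule.span F (Set.range fun j => plc (b j))) := Submodule.finrank_mono hle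
    _ ≤ Fintype.card (Fin (Module.finrank ℚ 𝔩)) := finrank_range_le_card _
    _ = Module.finrank ℚ 𝔩 := Fintype.card_fin _

omit [CharZero E] in
/-- `dim_E 𝔰𝔩₂(E) = 3` (rank–nullity for the surjective trace). [folklore] -/
private theorem finrank_ker_trace_fin_two :
    Module.finrank E (LinearMap.ker (Matrix.traceLinearMap (Fin 2) E E)) = 3 := by
  have hsurj : Function.Surjective (Matrix.traceLinearMap (Fin 2) E E) := by
    intro e
    refine ⟨!![e, 0; 0, 0], ?_⟩
    simp [Matrix.traceLinearMap_apply, Matrix.trace_fin_two]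
  have h1 := LinearMap.finrank_range_add_finrank_ker (Matrix.traceLinearMap (Fin 2) E E)
  have h2 : Module.finrank E (LinearMap.range (Matrix.traceLinearMap (Fin 2) E E)) = 1 := by
    rw [LinearMap.range_eq_top.2 hsurj, finrank_top, Module.finrank_self]
  have h3 : Module.finrank E (Matrix (Fin 2) (Fin 2) E) = 4 := by
    rw [Module.finrank_matrix, Module.finrank_self, Fintype.card_fin]
  omega

omit [CharZero E] in
/-- Membership in the trace-zero matrices. [folklore] -/
private theorem mem_ker_traceLinearMap {Y : Matrix (Fin 2) (Fin 2) E} :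
    Y ∈ LinearMap.ker (Matrix.traceLinearMap (Fin 2) E E) ↔ Y.trace = 0 := by
  simp [Matrix.traceLinearMap_apply]

/-- **`𝔩 = 𝔰𝔩₂(E)`.** If, in the situation of `three_mul_card_le_finrank_rat`, `E` is finite over `ℚ`
with `[E : ℚ] = |ι|` (ALL the real places of a totally real field), then the trace-free `ℚ`-Lie
subalgebra `𝔩` is ALL of `𝔰𝔩₂(E)`: `3[E:ℚ] = 3|ι| ≤ dim_ℚ 𝔩 ≤ dim_ℚ 𝔰𝔩₂(E) = 3[E:ℚ]`. For an abelian
variety `X` with real multiplication by `E`, `[E:ℚ] = dim X`, `End⁰(X) = E`: the `ℚ`-Lie hull of the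
Hodge operator is `𝔰𝔩₂(E) = Lie R_{E/ℚ} SL₂`, i.e. `Hg(X) = R_{E/ℚ} SL_{2,E}` (Hazama 1983 §3; Ribet 1983).
[cite: Hazama1983, §3 (pp. 305–306) and Thm. (1.1)] [cite: MoonenZarhin1999LowDim, §1] -/
theorem eq_traceZero_of_places [Module.Finite ℚ E] (σ : ι → (E →+* F))
    (hcard : Fintype.card ι = Module.finrank ℚ E)
    (𝔩 : Submodule ℚ (Matrix (Fin 2) (Fin 2) E))
    (hlie : ∀ A ∈ 𝔩, ∀ B ∈ 𝔩, A * B - B * A ∈ 𝔩) (htr : ∀ A ∈ 𝔩, A.trace = 0)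
    {J : ι → Matrix (Fin 2) (Fin 2) K}
    (hJ : J ∈ Submodule.span K
      ((fun Y : Matrix (Fin 2) (Fin 2) E => fun k => ((Y.map (σ k)).map (algebraMap F K))) '' 𝔩))
    (hi : ∀ (k : ι) (v : Fin 2 → F), v ≠ 0 → ∀ μ : K,
      (J k).mulVec (fun a => algebraMap F K (v a)) ≠ μ • fun a => algebraMap F K (v a))
    (hna : ∃ A ∈ 𝔩, ∃ B ∈ 𝔩, A * B - B * A ≠ 0)
    (hng : ∀ i k : ι, k ≠ i → ∀ g g' : Matrix (Fin 2) (Fin 2) F, g * g' = 1 → g' * g = 1 →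
      ∃ Y ∈ 𝔩, (Y.map (σ i)) ≠ g * Y.map (σ k) * g') :
    𝔩 = (LinearMap.ker (Matrix.traceLinearMap (Fin 2) E E)).restrictScalars ℚ := by
  classical
  set SL : Submodule ℚ (Matrix (Fin 2) (Fin 2) E) :=
    (LinearMap.ker (Matrix.traceLinearMap (Fin 2) E E)).restrictScalars ℚ with hSL
  have hle : 𝔩 ≤ SL := fun Y hY => by
    rw [hSL, Submodule.restrictScalars_mem, mem_ker_traceLinearMap]
    exact htr Y hY
  have hSLfin : Module.finrank ℚ SL = 3 * Module.finrank ℚ E := by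
    have h := Module.finrank_mul_finrank ℚ E (LinearMap.ker (Matrix.traceLinearMap (Fin 2) E E))
    rw [finrank_ker_trace_fin_two] at h
    have e := (Submodule.restrictScalarsEquiv ℚ E (Matrix (Fin 2) (Fin 2) E)
      (LinearMap.ker (Matrix.traceLinearMap (Fin 2) E E))).restrictScalars ℚ
    rw [hSL, e.finrank_eq, ← h, mul_comm]
  haveI : Module.Finite ℚ 𝔩 := Module.Finite.of_injective (Submodule.inclusion hle)
    (Submodule.inclusion_injective hle)
  refine Submodule.eq_of_le_of_finrank_le hle ?_
  rw [hSLfin, ← hcard]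
  exact three_mul_card_le_finrank_rat σ 𝔩 hlie htr hJ hi hna hng

end Places

end Literature.RepresentationTheory.GeneralLinear

end
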